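import Mathlib.MeasureTheory.Measure.Haar.Unique
import Mathlib.MeasureTheory.Group.Prod
import Mathlib.Topology.Algebra.ContinuousMonoidHom
import HarnessLib

/-!
# The ADDITIVE SUBMERSION BOUND: integrating along a split surjection of locally compact abelian groups

Literature-level, Mathlib-only, THEOREMS ONLY (no definition ∕ instance ∕ notation ∕ named fact ∕ `sorry`).  Cell `pub/hodgecm-mathlib`,
crux H413 = `stmt-HodgeConjecture-24833` (lane `--supports … --as helper`), road «HC-D» (holder ∕ dealer F0P2-p01 (g23)), brick D5(i) item (C0),
seat F0P3-p04 (g18), 2026-09-02.  HONEST LABEL: count-neutral; HC_CM is proved only modulo the printed citations (hLiu418 24832 ∕ h413 24833)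
until rung 0 closes; this file closes no organ.

## The statement (`exists_setLIntegral_fst_le_of_continuousAddEquiv`)

`S`, `A`, `N` second-countable locally compact abelian topological groups with Borel σ-algebras, `E : S ≃ₜ+ A × N` a topological-group
isomorphism (so `s ↦ (E s).1` is a SPLIT continuous surjection `S → A` with kernel `≅ N`), `μ`, `ν` additive Haar measures on `S`, `A`, and `K ⊆ S`
COMPACT.  Then there is a FINITE constant `C` (depending on `K`, `E`, `μ`, `ν`, not on the integrand) with

  **`∫⁻ s in K, g (E s).1 ∂μ ≤ C * ∫⁻ a in Prod.fst '' (E '' K), g a ∂ν`**   for every measurable `g : A → ℝ≥0∞`.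

This is the SCALAR-FREE form of ★ `Literature.MeasureTheory.Group.LinearSubmersionBound` (there: `𝕜`-linear surjections of normed spaces, kernel
complement chosen by linear algebra); here the splitting is the datum `E`, which is what the road's `F`-form submersion chart (★ D2♭
`exists_splitting_addEquiv`) produces on an additive subgroup that carries no scalar structure («R3♭: there is no `F`»).

## Proof

`μ.map E` is an additive Haar measure on `A × N` (Mathlib `ContinuousAddEquiv.isAddHaarMeasure_map`), hence equals `c • (ν.prod ρ)` for the product
of `ν` with an additive Haar measure `ρ` of `N` and a finite `c` (uniqueness, `isAddLeftInvariant_eq_smul`).  With `B = fst (E K)`, `T = snd (E K)` (compact):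
`∫⁻_K g (E s).1 ∂μ = ∫⁻_{E K} g p.1 ∂(μ.map E) = c ∫⁻_{E K} g p.1 ∂(ν × ρ) ≤ c ∫⁻_{B × T} g p.1 ∂(ν × ρ) = c · ρ T · ∫⁻_B g ∂ν` (Tonelli).  This is the quotient
integral formula for `G = A × N ⊵ N`, `G ∕ N ≅ A`, localised to a compact set. [DeitmarEchterhoff2014, Thm. 1.5.3]
-/

set_option autoImplicit false

noncomputable section

open MeasureTheory MeasureTheory.Measure Set
open scoped ENNReal

namespace Literature.MeasureTheory.Group

variable {S A N : Type*}
  [AddCommGroup S] [TopologicalSpace S] [IsTopologicalAddGroup S] [MeasurableSpace S] [BorelSpace S]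
  [AddCommGroup A] [TopologicalSpace A] [IsTopologicalAddGroup A] [LocallyCompactSpace A] [SecondCountableTopology A]
    [MeasurableSpace A] [BorelSpace A]
  [AddCommGroup N] [TopologicalSpace N] [IsTopologicalAddGroup N] [LocallyCompactSpace N] [SecondCountableTopology N]
    [MeasurableSpace N] [BorelSpace N]

/-- **Additive submersion bound.**  For a topological-group isomorphism `E : S ≃ₜ+ A × N` of second-countable locally compact abelian groups,
additive Haar measures `μ` on `S`, `ν` on `A`, and a compact `K ⊆ S`, there is `C < ∞` with
`∫⁻ s in K, g (E s).1 ∂μ ≤ C * ∫⁻ a in Prod.fst '' (E '' K), g a ∂ν` for every measurable `g : A → ℝ≥0∞` — the quotient integral formula for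
`A × N ⊵ N` localised to a compact set (scalar-free companion of ★ `exists_setLIntegral_comp_le_mul_setLIntegral_image`).
[cite: DeitmarEchterhoff2014, Thm. 1.5.3 (§1.5 quotient integral formula)] -/
theorem exists_setLIntegral_fst_le_of_continuousAddEquiv (E : S ≃ₜ+ A × N)
    (μ : Measure S) [μ.IsAddHaarMeasure] (ν : Measure A) [ν.IsAddHaarMeasure] {K : Set S} (hK : IsCompact K) :
    ∃ C : ℝ≥0∞, C < ∞ ∧ ∀ g : A → ℝ≥0∞, Measurable g →
      ∫⁻ s in K, g (E s).1 ∂μ ≤ C * ∫⁻ a in Prod.fst '' ((E : S → A × N) '' K), g a ∂ν := by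
  -- an additive Haar measure on `N` and the comparison of `μ.map E` with `ν.prod ρ`
  set ρ : Measure N := Measure.addHaar with hρ
  have hEm : Measurable (E : S → A × N) := E.continuous.measurable
  haveI : (μ.map (E : S → A × N)).IsAddHaarMeasure := E.isAddHaarMeasure_map μ
  set c := addHaarScalarFactor (μ.map (E : S → A × N)) (ν.prod ρ) with hc
  have hEq : μ.map (E : S → A × N) = c • ν.prod ρ := isAddLeftInvariant_eq_smul _ _
  -- the compact projections
  set B : Set A := Prod.fst '' ((E : S → A × N) '' K) with hB
  set T : Set N := Prod.snd '' ((E : S → A × N) '' K) with hT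
  have hEK : IsCompact ((E : S → A × N) '' K) := hK.image E.continuous
  have hTc : IsCompact T := hEK.image continuous_snd
  have hsub : (E : S → A × N) '' K ⊆ B ×ˢ T := fun p hp => ⟨mem_image_of_mem _ hp, mem_image_of_mem _ hp⟩
  refine ⟨(c : ℝ≥0∞) * ρ T, ENNReal.mul_lt_top ENNReal.coe_lt_top hTc.measure_lt_top, fun g hg => ?_⟩
  -- transport along `E`
  have hpres : MeasurePreserving (E : S → A × N) μ (μ.map (E : S → A × N)) := ⟨hEm, rfl⟩
  have e1 : ∫⁻ s in K, g (E s).1 ∂μ = ∫⁻ p in (E : S → A × N) '' K, g p.1 ∂(μ.map (E : S → A × N)) :=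
    hpres.setLIntegral_comp_emb E.toHomeomorph.measurableEmbedding (fun p : A × N => g p.1) K
  rw [e1, hEq, Measure.restrict_smul, lintegral_smul_measure]
  -- enlarge to the box and apply Tonelli
  have hgm : Measurable fun p : A × N => g p.1 := hg.comp measurable_fst
  have e2 : ∫⁻ p in B ×ˢ T, g p.1 ∂(ν.prod ρ) = (∫⁻ a in B, g a ∂ν) * ρ T := by
    rw [← Measure.prod_restrict, lintegral_prod _ hgm.aemeasurable]
    simp only [lintegral_const, Measure.restrict_apply_univ]
    rw [lintegral_mul_const _ hg]
  calc c • ∫⁻ p in (E : S → A × N) '' K, g p.1 ∂(ν.prod ρ)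
      ≤ c • ∫⁻ p in B ×ˢ T, g p.1 ∂(ν.prod ρ) := by
        gcongr c • ?_
        exact lintegral_mono_set hsub
    _ = (c : ℝ≥0∞) * ((∫⁻ a in B, g a ∂ν) * ρ T) := by rw [e2, ENNReal.smul_def, smul_eq_mul]
    _ = (c : ℝ≥0∞) * ρ T * ∫⁻ a in B, g a ∂ν := by ring

end Literature.MeasureTheory.Group

end
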